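import Summits.ResolutionOfSingularities.ResolutionOfSingularities.Theorems.FrobeniusLadderFInjectiveMacaulayficationFilteredReesCarrier
import Mathlib.RingTheory.Localization.Away.Basic
import Mathlib.RingTheory.Localization.Basic
import Mathlib.RingTheory.Ideal.Quotient.Operations
import Mathlib.RingTheory.Ideal.Maps
import HarnessLib

/-!
# (F4a) THE FIBRE `s = 0` OF THE FILTERED REES CARRIER: `π♮ : T′♮ ↠ (k[X]/(f₀))[1/x̄_v^c]` with kernel `(s)`
# (crux `FInjectiveMacaulayfication`, line `graded-engine` §17 filtered engine G4♮ — CRUX-PLAN v5 §1.3 piece (F4), first half)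

Support file for crux stmt-ResolutionOfSingularities-15315 (`FrobeniusLadder.FInjectiveMacaulayfication`), chain w45a,
seat res-L1-w45a-stub-3 (owner of (F0)/(F4)/(F5)). [OURS · L1 W4.5a] — NOT a statement of the manuscript; AI-written, weaker than
expert review.

Carrier as fixed in `FilteredReesCarrier` ((F0)): `A = MvPolynomial (Option (Fin n)) k`, `s = X none`, `X_j = X (some j)`,
`hfh : fh = Σ_b c_b X^b s^{w·b − D}`, `ℛ = A ⧸ (fh)`, `T′♮ = Localization.Away (x̄_v ^ c)`, `x̄_v = mk (X (some v))`; the cone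
`f₀ = weightedHomogeneousComponent w D f` and its chart `F = Localization.Away ((mk_{f₀} X_v) ^ c)` — the codomain that
`ConeFibreClause.coneFibreClause` (H-G4a♮, p482990) expects. This file produces the input `(π, hπ, hker)` of that lemma:

* `sub_rename_aeval_zero_mem` — the slice decomposition `a − (a|_{s=0} re-embedded) ∈ (s)`; `aeval_zero_fh` — `f^h|_{s=0} = f₀`;
* `exists_fibreMap_quotient` — `π₀ : ℛ →+* k[X]/(f₀)` with `π₀ ∘ mk = mk_{f₀} ∘ (s ↦ 0)`, SURJECTIVE, `ker π₀ = (s̄)`;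
* `exists_fibreMap` — **`π♮ : T′♮ →+* F` surjective with `ker π♮ = (s̄/1)`** and `π♮ ∘ algebraMap ∘ mk = algebraMap ∘ mk_{f₀} ∘ (s ↦ 0)`
  (`IsLocalization.map`; surjectivity `IsLocalization.map_surjective_of_surjective`; the kernel by clearing the denominator).

All proofs are glue on Mathlib and (F0); no definitions, no named facts. [folklore]
-/

-- single-problem summit: the doubled namespace component is forced
set_option linter.dupNamespace false

noncomputable section

namespace Summit.ResolutionOfSingularities.ResolutionOfSingularities.Theorems.FInjectiveMacaulayfication.FilteredReesFibre

open Summit.ResolutionOfSingularities.ResolutionOfSingularities.Theorems.FInjectiveMacaulayfication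

variable {k : Type} [Field k] {n : ℕ}

/-! ## Setting `s = 0` -/

/-- **Slice decomposition**: every `a ∈ k[X, s]` differs from the re-embedding of `a|_{s=0}` by a multiple of `s`. [folklore] -/
theorem sub_rename_aeval_zero_mem (a : MvPolynomial (Option (Fin n)) k) :
    a - MvPolynomial.rename some (MvPolynomial.aeval
      (fun o : Option (Fin n) => o.elim (0 : MvPolynomial (Fin n) k) MvPolynomial.X) a) ∈
      Ideal.span {(MvPolynomial.X none : MvPolynomial (Option (Fin n)) k)} := by
  induction a using MvPolynomial.induction_on with
  | C r =>
    rw [MvPolynomial.aeval_C, MvPolynomial.algebraMap_eq, MvPolynomial.rename_C, sub_self]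
    exact Ideal.zero_mem _
  | add p q hp hq =>
    have e : p + q - MvPolynomial.rename some (MvPolynomial.aeval
        (fun o : Option (Fin n) => o.elim (0 : MvPolynomial (Fin n) k) MvPolynomial.X) (p + q)) =
        (p - MvPolynomial.rename some (MvPolynomial.aeval
          (fun o : Option (Fin n) => o.elim (0 : MvPolynomial (Fin n) k) MvPolynomial.X) p)) +
        (q - MvPolynomial.rename some (MvPolynomial.aeval
          (fun o : Option (Fin n) => o.elim (0 : MvPolynomial (Fin n) k) MvPolynomial.X) q)) := by
      simp only [map_add]
      ring
    rw [e]
    exact Ideal.add_mem _ hp hq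
  | mul_X p o hp =>
    cases o with
    | none =>
      rw [map_mul, MvPolynomial.aeval_X, Option.elim_none, mul_zero, map_zero, sub_zero]
      exact Ideal.mul_mem_left _ _ (Ideal.subset_span rfl)
    | some j =>
      have e : p * MvPolynomial.X (some j) - MvPolynomial.rename some (MvPolynomial.aeval
          (fun o : Option (Fin n) => o.elim (0 : MvPolynomial (Fin n) k) MvPolynomial.X) (p * MvPolynomial.X (some j))) =
          (p - MvPolynomial.rename some (MvPolynomial.aeval
            (fun o : Option (Fin n) => o.elim (0 : MvPolynomial (Fin n) k) MvPolynomial.X) p)) * MvPolynomial.X (some j) := by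
        rw [map_mul, MvPolynomial.aeval_X, Option.elim_some, map_mul, MvPolynomial.rename_X]
        ring
      rw [e]
      exact Ideal.mul_mem_right _ _ hp

/-- **`f^h` at `s = 0` is the initial form `f₀`.** [folklore] -/
theorem aeval_zero_fh (w : Fin n → ℕ) (D : ℕ) (f : MvPolynomial (Fin n) k) (fh : MvPolynomial (Option (Fin n)) k)
    (hfh : fh = ∑ b ∈ f.support, MvPolynomial.monomial
      (Finsupp.mapDomain some b + Finsupp.single none (Finsupp.weight w b - D)) (MvPolynomial.coeff b f))
    (hD0 : ∀ m < D, MvPolynomial.weightedHomogeneousComponent w m f = 0) :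
    MvPolynomial.aeval (fun o : Option (Fin n) => o.elim (0 : MvPolynomial (Fin n) k) MvPolynomial.X) fh =
      MvPolynomial.weightedHomogeneousComponent w D f := by
  obtain ⟨q, hq⟩ := Ideal.mem_span_singleton'.mp (FilteredReesCarrier.fh_sub_rename_initialForm_mem w D f fh hfh hD0)
  have h1 : fh = MvPolynomial.rename some (MvPolynomial.weightedHomogeneousComponent w D f) + q * MvPolynomial.X none := by
    rw [hq, add_sub_cancel]
  rw [h1, map_add, FilteredReesCarrier.aeval_zero_rename, map_mul, MvPolynomial.aeval_X, Option.elim_none, mul_zero,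
    add_zero]

/-! ## The fibre map on the quotient `ℛ = k[X, s]/(f^h)` -/

/-- **`π₀ : ℛ ↠ k[X]/(f₀)` with kernel `(s̄)`.** [folklore] -/
theorem exists_fibreMap_quotient (w : Fin n → ℕ) (D : ℕ) (f : MvPolynomial (Fin n) k) (fh : MvPolynomial (Option (Fin n)) k)
    (hfh : fh = ∑ b ∈ f.support, MvPolynomial.monomial
      (Finsupp.mapDomain some b + Finsupp.single none (Finsupp.weight w b - D)) (MvPolynomial.coeff b f))
    (hD0 : ∀ m < D, MvPolynomial.weightedHomogeneousComponent w m f = 0)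
    (f₀ : MvPolynomial (Fin n) k) (hf₀ : f₀ = MvPolynomial.weightedHomogeneousComponent w D f) :
    ∃ π₀ : (MvPolynomial (Option (Fin n)) k ⧸ Ideal.span {fh}) →+* (MvPolynomial (Fin n) k ⧸ Ideal.span {f₀}),
      (∀ a, π₀ (Ideal.Quotient.mk (Ideal.span {fh}) a) = Ideal.Quotient.mk (Ideal.span {f₀})
        (MvPolynomial.aeval (fun o : Option (Fin n) => o.elim (0 : MvPolynomial (Fin n) k) MvPolynomial.X) a)) ∧
      Function.Surjective π₀ ∧
      RingHom.ker π₀ = Ideal.span {Ideal.Quotient.mk (Ideal.span {fh}) (MvPolynomial.X none)} := by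
  have hev : MvPolynomial.aeval (fun o : Option (Fin n) => o.elim (0 : MvPolynomial (Fin n) k) MvPolynomial.X) fh = f₀ := by
    rw [hf₀]; exact aeval_zero_fh w D f fh hfh hD0
  have hker : ∀ a ∈ Ideal.span {fh}, ((Ideal.Quotient.mk (Ideal.span {f₀})).comp
      (MvPolynomial.aeval (fun o : Option (Fin n) => o.elim (0 : MvPolynomial (Fin n) k) MvPolynomial.X)).toRingHom) a = 0 := by
    intro a ha
    obtain ⟨q, rfl⟩ := Ideal.mem_span_singleton'.mp ha
    rw [RingHom.comp_apply, AlgHom.toRingHom_eq_coe, RingHom.coe_coe, map_mul, hev, Ideal.Quotient.eq_zero_iff_mem]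
    exact Ideal.mul_mem_left _ _ (Ideal.mem_span_singleton_self f₀)
  refine ⟨Ideal.Quotient.lift _ _ hker, fun a => by rw [Ideal.Quotient.lift_mk]; rfl, ?_, ?_⟩
  · -- surjective
    intro y
    obtain ⟨g, rfl⟩ := Ideal.Quotient.mk_surjective y
    refine ⟨Ideal.Quotient.mk _ (MvPolynomial.rename some g), ?_⟩
    rw [Ideal.Quotient.lift_mk, RingHom.comp_apply, AlgHom.toRingHom_eq_coe, RingHom.coe_coe,
      FilteredReesCarrier.aeval_zero_rename]
  · -- kernel
    apply le_antisymm
    · intro x hx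
      obtain ⟨a, rfl⟩ := Ideal.Quotient.mk_surjective x
      rw [RingHom.mem_ker, Ideal.Quotient.lift_mk, RingHom.comp_apply, AlgHom.toRingHom_eq_coe, RingHom.coe_coe,
        Ideal.Quotient.eq_zero_iff_mem] at hx
      obtain ⟨q, hq⟩ := Ideal.mem_span_singleton'.mp hx
      -- `a = (a - rename (a|₀)) + rename q · (rename f₀)`, and `rename f₀ ≡ fh (mod s)`
      have hmap : Ideal.span {Ideal.Quotient.mk (Ideal.span {fh}) (MvPolynomial.X none)} =
          (Ideal.span {(MvPolynomial.X none : MvPolynomial (Option (Fin n)) k)}).map (Ideal.Quotient.mk (Ideal.span {fh})) := by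
        rw [Ideal.map_span, Set.image_singleton]
      rw [hmap]
      have e : a = (a - MvPolynomial.rename some (MvPolynomial.aeval
          (fun o : Option (Fin n) => o.elim (0 : MvPolynomial (Fin n) k) MvPolynomial.X) a)) +
          MvPolynomial.rename some q * ((MvPolynomial.rename some f₀ - fh) + fh) := by
        rw [sub_add_cancel, ← map_mul, hq, sub_add_cancel]
      rw [e, map_add, map_mul, map_add, Ideal.Quotient.eq_zero_iff_mem.mpr (Ideal.mem_span_singleton_self fh), add_zero]
      refine Ideal.add_mem _ (Ideal.mem_map_of_mem _ (sub_rename_aeval_zero_mem a)) (Ideal.mul_mem_left _ _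
        (Ideal.mem_map_of_mem _ ?_))
      have h2 := Submodule.neg_mem _ (FilteredReesCarrier.fh_sub_rename_initialForm_mem w D f fh hfh hD0)
      rwa [neg_sub, ← hf₀] at h2
    · rw [Ideal.span_le, Set.singleton_subset_iff, SetLike.mem_coe, RingHom.mem_ker, Ideal.Quotient.lift_mk,
        RingHom.comp_apply, AlgHom.toRingHom_eq_coe, RingHom.coe_coe, MvPolynomial.aeval_X, Option.elim_none, map_zero]

/-! ## The fibre map on the chart `T′♮ = ℛ[1/x̄_v^c]` -/

/-- **(F4a) `π♮ : T′♮ ↠ (k[X]/(f₀))[1/x̄_v^c]` with kernel `(s̄/1)`** — the input of `ConeFibreClause.coneFibreClause` for the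
filtered engine. [folklore] -/
theorem exists_fibreMap (w : Fin n → ℕ) (D : ℕ) (f : MvPolynomial (Fin n) k) (fh : MvPolynomial (Option (Fin n)) k)
    (hfh : fh = ∑ b ∈ f.support, MvPolynomial.monomial
      (Finsupp.mapDomain some b + Finsupp.single none (Finsupp.weight w b - D)) (MvPolynomial.coeff b f))
    (hD0 : ∀ m < D, MvPolynomial.weightedHomogeneousComponent w m f = 0)
    (f₀ : MvPolynomial (Fin n) k) (hf₀ : f₀ = MvPolynomial.weightedHomogeneousComponent w D f) (v : Fin n) (c : ℕ) :
    ∃ π : Localization.Away (Ideal.Quotient.mk (Ideal.span {fh}) (MvPolynomial.X (some v)) ^ c) →+*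
        Localization.Away (Ideal.Quotient.mk (Ideal.span {f₀}) (MvPolynomial.X v) ^ c),
      (∀ a, π (algebraMap _ _ (Ideal.Quotient.mk (Ideal.span {fh}) a)) = algebraMap _ _ (Ideal.Quotient.mk (Ideal.span {f₀})
        (MvPolynomial.aeval (fun o : Option (Fin n) => o.elim (0 : MvPolynomial (Fin n) k) MvPolynomial.X) a))) ∧
      Function.Surjective π ∧
      RingHom.ker π = Ideal.span {algebraMap _ (Localization.Away (Ideal.Quotient.mk (Ideal.span {fh}) (MvPolynomial.X (some v)) ^ c))
        (Ideal.Quotient.mk (Ideal.span {fh}) (MvPolynomial.X none))} := by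
  obtain ⟨π₀, hπ₀, hsurj, hker⟩ := exists_fibreMap_quotient w D f fh hfh hD0 f₀ hf₀
  have hπ₀u : π₀ (Ideal.Quotient.mk (Ideal.span {fh}) (MvPolynomial.X (some v)) ^ c) =
      Ideal.Quotient.mk (Ideal.span {f₀}) (MvPolynomial.X v) ^ c := by
    rw [map_pow, hπ₀, MvPolynomial.aeval_X, Option.elim_some]
  -- the target is a localization at the image submonoid
  haveI : IsLocalization ((Submonoid.powers (Ideal.Quotient.mk (Ideal.span {fh}) (MvPolynomial.X (some v)) ^ c)).map π₀)
      (Localization.Away (Ideal.Quotient.mk (Ideal.span {f₀}) (MvPolynomial.X v) ^ c)) := by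
    rw [Submonoid.map_powers, hπ₀u]
    infer_instance
  refine ⟨IsLocalization.map (Localization.Away (Ideal.Quotient.mk (Ideal.span {f₀}) (MvPolynomial.X v) ^ c)) π₀
    (Submonoid.powers (Ideal.Quotient.mk (Ideal.span {fh}) (MvPolynomial.X (some v)) ^ c)).le_comap_map, ?_, ?_, ?_⟩
  · intro a
    rw [IsLocalization.map_eq, hπ₀]
  · exact IsLocalization.map_surjective_of_surjective
      (Submonoid.powers (Ideal.Quotient.mk (Ideal.span {fh}) (MvPolynomial.X (some v)) ^ c))
      (Localization.Away (Ideal.Quotient.mk (Ideal.span {fh}) (MvPolynomial.X (some v)) ^ c))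
      (Localization.Away (Ideal.Quotient.mk (Ideal.span {f₀}) (MvPolynomial.X v) ^ c)) hsurj
  · apply le_antisymm
    · intro z hz
      obtain ⟨⟨a, y⟩, hay⟩ := IsLocalization.mk'_surjective
        (Submonoid.powers (Ideal.Quotient.mk (Ideal.span {fh}) (MvPolynomial.X (some v)) ^ c)) z
      dsimp only at hay
      rw [← hay] at hz ⊢
      rw [RingHom.mem_ker, IsLocalization.map_mk', IsLocalization.mk'_eq_zero_iff] at hz
      obtain ⟨⟨t, ht⟩, hta⟩ := hz
      obtain ⟨b, hb, rfl⟩ := Submonoid.mem_map.mp ht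
      have hab : a * b ∈ RingHom.ker π₀ := by
        rw [RingHom.mem_ker, map_mul, mul_comm]
        exact hta
      rw [hker] at hab
      have e : IsLocalization.mk' (Localization.Away (Ideal.Quotient.mk (Ideal.span {fh}) (MvPolynomial.X (some v)) ^ c)) a y =
          algebraMap _ (Localization.Away (Ideal.Quotient.mk (Ideal.span {fh}) (MvPolynomial.X (some v)) ^ c)) (a * b) *
            IsLocalization.mk' (Localization.Away (Ideal.Quotient.mk (Ideal.span {fh}) (MvPolynomial.X (some v)) ^ c)) 1
              (y * ⟨b, hb⟩) := by
        rw [← IsLocalization.mk'_eq_mul_mk'_one]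
        exact (IsLocalization.mk'_cancel a y ⟨b, hb⟩).symm
      rw [e]
      refine Ideal.mul_mem_right _ _ ?_
      have hmem := Ideal.mem_map_of_mem
        (algebraMap _ (Localization.Away (Ideal.Quotient.mk (Ideal.span {fh}) (MvPolynomial.X (some v)) ^ c))) hab
      rwa [Ideal.map_span, Set.image_singleton] at hmem
    · rw [Ideal.span_le, Set.singleton_subset_iff, SetLike.mem_coe, RingHom.mem_ker, IsLocalization.map_eq]
      have h0 : π₀ (Ideal.Quotient.mk (Ideal.span {fh}) (MvPolynomial.X none)) = 0 := by
        rw [← RingHom.mem_ker, hker]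
        exact Ideal.mem_span_singleton_self _
      rw [h0, map_zero]

end Summit.ResolutionOfSingularities.ResolutionOfSingularities.Theorems.FInjectiveMacaulayfication.FilteredReesFibre

end
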